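import Summits.PneNP.PneNP.Theorems.SzkEntropyPeaWorstToAvgStubOrbitKitBridge
import Summits.PneNP.PneNP.Theorems.SzkEntropyPeaWorstToAvgStubOrbitKitLaw
import HarnessLib

/-!
# Orbit kit for `orbit-pair-rsr`, VI: the re-randomised law is `1/16`-close to the planted law

Helper file of the stub `stub_orbitKit` (crux `SzkEntropy.PeaWorstToAvg`, line `orbit-pair-rsr`).
The probabilistic heart of the orbit kit:

* `sum_translate_le` — if two probability vectors on a finite set both dominate `u · U` pointwise, then
  for every injection `π` and event `S`, `μ'(π⁻¹ S) ≤ μ(S) + (1 - u·|G|)`;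
* `mulG` — right translation `g ↦ g · g₀` in `AGL_s × AGL_m` (injective), and `outG_translate`:
  by uniqueness of the normal form, re-randomising a point `q = g₀ • p` of the orbit by `g` gives the
  normalised transform of `p` by `g · g₀`;
* **`close`** — for `q` in the orbit of the cubic map `p`, every event has, under the normalised
  transform of `q` by the sampled group element, probability at most that under the normalised
  transform of `p`, plus `2 (¾)^t` (`≤ 1/16` for `t ≥ 13`).

References: folklore (random self-reduction inside an orbit); Bogdanov–Trevisan, FnT–TCS 2 (2006),
§2; J. Patarin, EUROCRYPT 1996, §2.
-/

namespace Summit.PneNP.PneNP.Cruxes.PeaWorstToAvg.OrbitPairRsr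

set_option linter.dupNamespace false -- Summit.PneNP.PneNP: summit = sub-problem (D-0017)

open Literature.Computability.Complexity Literature.Computability.MetaComplexity Finset

namespace OKit

/-! ### Translation under near-uniform laws -/

/-- **Translation costs at most the non-uniform mass.** If `μ, μ' ≥ u ≥ 0` pointwise on a finite set
`G`, `Σ μ' = 1`, and `π : G → G` is injective, then `Σ_{π g ∈ S} μ' g ≤ Σ_{g ∈ S} μ g + (1 - u |G|)`.
[folklore] -/
theorem sum_translate_le {G : Type} [Fintype G] [DecidableEq G] (μ μ' : G → ℝ) {u : ℝ} (hu : 0 ≤ u)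
    (hμ : ∀ g, u ≤ μ g) (hμ' : ∀ g, u ≤ μ' g) (hsum : ∑ g, μ' g = 1) {π : G → G} (hπ : Function.Injective π)
    (S : Finset G) :
    ∑ g ∈ univ.filter (fun g => π g ∈ S), μ' g ≤ ∑ g ∈ S, μ g + (1 - u * Fintype.card G) := by
  set T := univ.filter (fun g => π g ∈ S) with hT
  have hcard : T.card ≤ S.card := by
    calc T.card = (T.image π).card := (card_image_of_injective T hπ).symm
      _ ≤ S.card := card_le_card fun x hx => by
          obtain ⟨g, hg, rfl⟩ := mem_image.1 hx
          exact (mem_filter.1 hg).2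
  have h1 : ∑ g ∈ T, μ' g = ∑ g ∈ T, (μ' g - u) + u * T.card := by
    rw [sum_sub_distrib, sum_const, nsmul_eq_mul]; ring
  have h2 : ∑ g ∈ T, (μ' g - u) ≤ ∑ g, (μ' g - u) :=
    sum_le_sum_of_subset_of_nonneg (subset_univ T) fun g _ _ => sub_nonneg.2 (hμ' g)
  have h3 : ∑ g, (μ' g - u) = 1 - u * Fintype.card G := by
    rw [sum_sub_distrib, hsum, sum_const, nsmul_eq_mul, Finset.card_univ]; ring
  have h4 : u * S.card ≤ ∑ g ∈ S, μ g := by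
    calc u * S.card = ∑ _g ∈ S, u := by rw [sum_const, nsmul_eq_mul]; ring
      _ ≤ ∑ g ∈ S, μ g := sum_le_sum fun g _ => hμ g
  have h5 : u * T.card ≤ u * S.card := mul_le_mul_of_nonneg_left (by exact_mod_cast hcard) hu
  linarith

/-! ### Right translation in the group -/

variable {s m : ℕ}

/-- Right translation by `g₀ = (A₀, b₀, B₀, c₀)`: `(A, b, B, c) ↦ (A₀ A, A₀ b + b₀, B B₀, B c₀ + c)`,
the group element of `x ↦ B (B₀ · + c₀) + c ∘ … ∘ A₀ (A x + b) + b₀`. [cite: Patarin1996, §2] -/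
def mulT (g₀ g : Tup s m) : Tup s m :=
  (g₀.1 * g.1, g₀.1.mulVec g.2.1 + g₀.2.1, g.2.2.1 * g₀.2.2.1, g.2.2.1.mulVec g₀.2.2.2 + g.2.2.2)

/-- Right translation preserves invertibility. [folklore] -/
def mulG (g₀ g : Grp s m) : Grp s m :=
  ⟨mulT g₀.1 g.1, g₀.2.1.mul g.2.1, g.2.2.mul g₀.2.2⟩

/-- Right translation is injective. [folklore] -/
theorem mulG_injective (g₀ : Grp s m) : Function.Injective (mulG g₀) := by
  rintro ⟨⟨A, b, B, c⟩, hA, hB⟩ ⟨⟨A', b', B', c'⟩, hA', hB'⟩ h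
  have h' := congrArg Subtype.val h
  simp only [mulG, mulT, Prod.mk.injEq] at h'
  obtain ⟨h1, h2, h3, h4⟩ := h'
  have eA : A = A' := g₀.2.1.mul_right_injective h1
  have eb : b = b' := (Matrix.mulVec_injective_iff_isUnit.2 g₀.2.1) (add_right_cancel h2)
  have eB : B = B' := g₀.2.2.mul_left_injective h3
  subst eA eb eB
  have ec : c = c' := add_left_cancel h4
  subst ec
  rfl

/-! ### The normalised transform by a group element -/

/-- The normalised transform of an untyped map by a typed tuple. [folklore] -/
def outG (s : ℕ) {m : ℕ} (P : List (List (List ℕ))) (g : Tup s m) : List (List (List ℕ)) :=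
  outMap s P (rowsOf g.1) (List.ofFn g.2.1) (rowsOf g.2.2.1) (List.ofFn g.2.2.2)

/-- **The coin-level transform factors through the typed read-out** (by uniqueness of the normal form:
the lists read off the coins and their typed versions present the same function). [folklore] -/
theorem outMapG_eq_outG {s m t : ℕ} (p : PolyMapF2 s) (hp : p.DegLE 3) (hm : p.length = m) (r : List Bool) :
    outMapG s m t (p.map (List.map (List.map Fin.val))) r =
      outG s (p.map (List.map (List.map Fin.val))) (gT s m t r) := by
  subst hm
  exact outMap_eq_outMap hp hp rfl fun x => by simp [gT]

/-- **Re-randomising a point of the orbit**: if `q = g₀ • p` (semantically), the normalised transform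
of `q` by `g` is the normalised transform of `p` by `g · g₀`. [cite: Patarin1996, §2] -/
theorem outG_translate {s : ℕ} (p q : PolyMapF2 s) (hp : p.DegLE 3) (hq : q.DegLE 3) (hlen : q.length = p.length)
    (g₀ : Tup s p.length)
    (hrel : ∀ x, q.eval x = affOut g₀.2.2.1 g₀.2.2.2 (p.eval (g₀.1.mulVec x + g₀.2.1))) (g : Tup s p.length) :
    outG s (q.map (List.map (List.map Fin.val))) g = outG s (p.map (List.map (List.map Fin.val))) (mulT g₀ g) := by
  refine outMap_eq_outMap hq hp hlen fun x => ?_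
  rw [affOut_matT_cast hlen]
  simp only [matT_rowsOf, vecT_ofFn, mulT]
  rw [hrel, affOut_affOut, mulVec_affine]

/-! ### Closeness -/

/-- **The re-randomised law is close to the planted law.** For `q` in the affine orbit of the cubic
map `p` (`q = g₀ • p`), every event `E` on output strings has, under "normalised transform of `q` by
the group element read off `N'` uniform coins", probability at most its probability under
"normalised transform of `p` by the group element read off `N` uniform coins" plus `2 (¾)^t`, as soon
as `N, N' ≥ need`: the first law is the second translated by `g₀`, and both read-out laws dominate
`(1 - 2(¾)^t)`-times the uniform law of the group. [folklore] -/
theorem close {s t : ℕ} (p q : PolyMapF2 s) (hp : p.DegLE 3) (hq : q.DegLE 3) (hlen : q.length = p.length)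
    (g₀ : Grp s p.length)
    (hrel : ∀ x, q.eval x = affOut g₀.1.2.2.1 g₀.1.2.2.2 (p.eval (g₀.1.1.mulVec x + g₀.1.2.1)))
    (out : List (List (List ℕ)) → List Bool) (E : Set (List Bool)) {N N' : ℕ}
    (hN : need s p.length t ≤ N) (hN' : need s p.length t ≤ N') :
    (cnt N' {ρ | out (outMapG s p.length t (q.map (List.map (List.map Fin.val))) ρ) ∈ E} : ℝ) / 2 ^ N' ≤
      (cnt N {r | out (outMapG s p.length t (p.map (List.map (List.map Fin.val))) r) ∈ E} : ℝ) / 2 ^ N +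
        2 * (3 / 4 : ℝ) ^ t := by
  classical
  set P' := p.map (List.map (List.map Fin.val))
  set Q' := q.map (List.map (List.map Fin.val))
  set S : Finset (Grp s p.length) := univ.filter fun h => out (outG s P' h.1) ∈ E with hS
  -- the planted side as a sum over the group
  have hsamp : (cnt N {r | out (outMapG s p.length t P' r) ∈ E} : ℝ) / 2 ^ N = ∑ h ∈ S, law s p.length t N h := by
    have hc : cnt N {r | out (outMapG s p.length t P' r) ∈ E} = cnt N {r | gT' s p.length t r ∈ S} :=
      cnt_congr fun r _ => by
        simp only [Set.mem_setOf_eq, hS, mem_filter, mem_univ, true_and, gT']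
        rw [outMapG_eq_outG p hp rfl]
    rw [hc, cnt_gT'_eq_sum s p.length t N (fun g => g ∈ S), sum_div, sum_filter]
    refine sum_congr rfl fun h _ => ?_
    simp only [hS, mem_filter, mem_univ, true_and]
    split_ifs <;> simp [law]
  -- the re-randomised side as a sum over the translated event
  have hrer : (cnt N' {ρ | out (outMapG s p.length t Q' ρ) ∈ E} : ℝ) / 2 ^ N' =
      ∑ g ∈ univ.filter (fun g => mulG g₀ g ∈ S), law s p.length t N' g := by
    have hc : cnt N' {ρ | out (outMapG s p.length t Q' ρ) ∈ E} = cnt N' {ρ | mulG g₀ (gT' s p.length t ρ) ∈ S} :=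
      cnt_congr fun ρ _ => by
        simp only [Set.mem_setOf_eq, hS, mem_filter, mem_univ, true_and, gT', mulG]
        rw [outMapG_eq_outG q hq hlen, outG_translate p q hp hq hlen g₀.1 hrel]
    rw [hc, cnt_gT'_eq_sum s p.length t N' (fun g => mulG g₀ g ∈ S), sum_div, sum_filter]
    refine sum_congr rfl fun h _ => ?_
    split_ifs <;> simp [law]
  rw [hsamp, hrer]
  have hu : (0 : ℝ) ≤ (1 - (singCount s / 2 ^ (s * s) : ℝ) ^ t) / glCount s * (1 / 2 ^ s) *
      ((1 - (singCount p.length / 2 ^ (p.length * p.length) : ℝ) ^ t) / glCount p.length * (1 / 2 ^ p.length)) :=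
    mul_nonneg (mul_nonneg (div_nonneg (one_sub_sigma_pow_nonneg s t) (by positivity)) (by positivity))
      (mul_nonneg (div_nonneg (one_sub_sigma_pow_nonneg _ t) (by positivity)) (by positivity))
  refine (sum_translate_le (law s p.length t N) (law s p.length t N') hu (law_ge hN) (law_ge hN')
    (sum_law s p.length t N') (mulG_injective g₀) S).trans ?_
  have := one_sub_u_card_le s p.length t
  linarith

end OKit

/-- **Closeness of the re-randomised law (anchor of the helper file).** [folklore] -/
theorem orbitKit_close {s t : ℕ} (p q : PolyMapF2 s) (hp : p.DegLE 3) (hq : q.DegLE 3) (hlen : q.length = p.length)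
    (g₀ : OKit.Grp s p.length)
    (hrel : ∀ x, q.eval x = affOut g₀.1.2.2.1 g₀.1.2.2.2 (p.eval (g₀.1.1.mulVec x + g₀.1.2.1)))
    (out : List (List (List ℕ)) → List Bool) (E : Set (List Bool)) {N N' : ℕ}
    (hN : OKit.need s p.length t ≤ N) (hN' : OKit.need s p.length t ≤ N') :
    (cnt N' {ρ | out (OKit.outMapG s p.length t (q.map (List.map (List.map Fin.val))) ρ) ∈ E} : ℝ) / 2 ^ N' ≤
      (cnt N {r | out (OKit.outMapG s p.length t (p.map (List.map (List.map Fin.val))) r) ∈ E} : ℝ) / 2 ^ N +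
        2 * (3 / 4 : ℝ) ^ t :=
  OKit.close p q hp hq hlen g₀ hrel out E hN hN'

end Summit.PneNP.PneNP.Cruxes.PeaWorstToAvg.OrbitPairRsr
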